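import Literature.NumberTheory.EllipticCurves.TianYuanZhang2017.UPlusOfGenusPointData
import Literature.NumberTheory.EllipticCurves.TianYuanZhang2017.RhoIndexTorsionClasses
import Summits.BirchSwinnertonDyer.Rank1Residual.P2.CongruentNumberLevelTwoDoor
import HarnessLib

/-!
# WORKFILE (crux stmt-BirchSwinnertonDyer-20509 `PrintCf2.RamifiedOffTYZOfFacts`, line `offtyz-v7` / registry skeleton v9, LEAD cruxlead-20509 g15)
# — THE SPECIAL-GENERATOR STRATUM OF C⁺: the two `ρ`-LAWS (conjectures, census-backed) and the residual research statement, TYPED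

Status: CONJECTURES / RESEARCH STATEMENTS typed for the planner, the disprover and the next lead; `def … : Prop` only because this is a crux
WORKFILE (`Cruxes/RamifiedOffTYZOfFacts/Lines/`), never a Theorems/Literature proposal.  Nothing here is asserted.  Companion memo:
`Lines/offtyz_v7_SpecialStratum.md` (method, census, validation, proof path).  BSD is not proved by any of this; no class is closed.

## What was measured (kit-free; `instruments/descent_A.py`, evidence #48 on 20509)
`2^{ρ(n)} = [E_n(ℚ) : φ_n(A_n(ℚ)) + E_n[2]]` (tree: `(rhoSubgroup n).index`).  On the odd two-prime jump-one class (`n = lm`, `l ≡ 1 (8)`,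
`m ≡ 5` [R1] or `7` [R2] `(mod 8)`, `(m/l) = 1`; `#Sel₂(E_n) = 2⁵`, `#Sel₄(E_n) = 2⁶`, `r = 1`; census `Ideas/census-1e5`, n ≤ 10⁵, 1434 members):
`ρ(n) = 0` (the SPECIAL stratum: `x(R) ∈ {±1, ±n}ℚ^{×2}`, the half `Q₁` frozen, no landed lower-half theorem applies) for 574 = 40.0 %.
Decided through `ρ(n) = 1 ⟺ Ш(A_n)[2] = 0 ⟺ dim Sel₂(A_n/ℚ) = 2` (Cassels' isogeny invariance + `c₂(A_n) = 2, 4` for `n ≡ ±3, ±1 (8)`,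
`Ω(E_n) = 2Ω(A_n)`, …; valid when `k₃ − [n ≡ 7 (8)] = 0`, in particular on R1/R2), with a Shapiro 2-descent on `A_n : Y² = X³ + 4n²X`
(`H¹(ℚ, A_n[2]) ≅ ℚ(i)^×/ℚ(i)^{×2}`).  Self-checks 1568/1568; explicit witnesses both ways (memo §1, rev 2).

## The laws (0 exceptions)
* (ρ-R1) `n ∈ R1 ∩ G` (798): `ρ(n) = 0 ⟺ 4 ∣ h(ℚ(√(lm))) ⟺ (l/m)₄ = (m/l)₄` (Scholz).
* (ρ-R2) `n ∈ R2 ∩ G` (636): `ρ(n) = 0 ⟺ 8 ∣ h(−4l) = #Cl(ℚ(√−l)) ⟺ 4 ∣ g(l) ⟺ (2/l)₄ = (−1)^{(l−1)/8}` (Barrucand–Cohn: `⟺ l = a² + 32b²`).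
Uniformly: `Sel^{(φ)}(E_n) = {1, d₁, d₂, d₁d₂}` (`{l, m}` resp. `{2, l}`) and `ρ(n) = 1 ⟺ [d₁, −1, d₂] = −1` (Rédei symbol) ⟺ the Cassels
pairing on `Sel^{(φ)}(E_n) ≅ 𝔽₂²` is non-degenerate ⟺ `S̃^{(φ)}(E_n) = {1}` in the notation of [OZ15, Lemma 2.3 / Prop. 2.4 (2)] — a
second-2-descent statement.  PROOF PATH (paper): [OZ15] Ouyang–Zhang, Acta Arith. 170 (2015) 343–360, Lemma 2.3 + Prop. 2.8 adapted to
`n ≡ 5, 7 (8)` + Burde's rational quartic reciprocity.  NOT kernel-provable today (no Cassels–Tate pairing / second descent in the tree).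
Why they matter for C⁺: they say BY NAME which members the landed lower half (aside 23304; g14 p754196 even) does NOT reach.

## What is typed below
`SectorR1`, `SectorR2` (prime shapes; `s = 3` is carried by the Selmer hypothesis), `RealFourDivides l m` («`4 ∣ h(ℚ(√(lm)))`», in any quadratic
field of `√(lm)`, `Tian2014.IsQuadraticFieldOfSqrt`), the conjectures `RhoLawR1`, `RhoLawR2` (support-grade), and the crux-grade research statement
`LowerHalfRhoZeroOdd` = the lower half of C⁺ on the special stratum (odd `n`, `s ≥ 2`) — the EXACT residual of the odd lower half by the
kernel theorem `SpecialStratum.two_dvd_scriptL_odd_of_rhoZero_statement` (`Theorems/PrintCf2RamifiedOffTYZLowerHalfRhoDichotomy.lean`, this cycle);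
plus the pure-logic sanity link `lowerHalfOdd_of_rhoZero_of_rhoNeZero`.
-/

noncomputable section

open scoped Classical

open WeierstrassCurve Literature.NumberTheory.EllipticCurves Literature.NumberTheory.EllipticCurves.TianYuanZhang2017
  Literature.NumberTheory.EllipticCurves.Tian2014

set_option autoImplicit false

namespace Summit.BirchSwinnertonDyer.PrintCf2.SpecialStratum.Laws

/-- Sector R1 of the odd two-prime jump-one class: `n = l·m`, `l ≡ 1`, `m ≡ 5 (mod 8)` primes with `(m/l) = +1` (then `s(lm) = 3`, Monsky). -/
def SectorR1 (l m : ℕ) : Prop :=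
  l.Prime ∧ m.Prime ∧ l % 8 = 1 ∧ m % 8 = 5 ∧ jacobiSym m l = 1

/-- Sector R2: `n = l·m`, `l ≡ 1`, `m ≡ 7 (mod 8)` primes with `(m/l) = +1`. -/
def SectorR2 (l m : ℕ) : Prop :=
  l.Prime ∧ m.Prime ∧ l % 8 = 1 ∧ m % 8 = 7 ∧ jacobiSym m l = 1

/-- «`4` divides the (wide) class number of the real quadratic field `ℚ(√(lm))`», read in any number field of degree 2 containing `√(lm)`. -/
def RealFourDivides (l m : ℕ) : Prop :=
  ∀ (K : Type) [Field K] [NumberField K], IsQuadraticFieldOfSqrt K ((l * m : ℕ) : ℤ) →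
    4 ∣ Nat.card (ClassGroup (NumberField.RingOfIntegers K))

/-- **CONJECTURE (ρ-R1), support-grade, census 798/798:** on R1 ∩ jump-one (`#Sel₂ = 2⁵`, `#Sel₄ = 2⁶`, `ord_{s=1} L(E_n,s) = 1`),
`ρ(lm) = 0 ⟺ 4 ∣ h(ℚ(√(lm)))` (⟺ `(l/m)₄ = (m/l)₄`, Scholz).  A second-2-descent statement (Cassels pairing on `Sel^{(φ)}(E_{lm})`); proof path
[OZ15] §2 + Burde; not kernel-provable today. -/
def RhoLawR1 : Prop :=
  ∀ (l m : ℕ) [(congruentNumberCurve (l * m)).IsElliptic], SectorR1 l m →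
    (congruentNumberCurve (l * m)).analyticRank = 1 →
    Nat.card ((congruentNumberCurve (l * m)).selmerGroup 2) = 2 ^ 5 →
    Nat.card ((congruentNumberCurve (l * m)).selmerGroup 4) = 2 ^ 6 →
    ((rhoSubgroup (l * m)).index = 1 ↔ RealFourDivides l m)

/-- **CONJECTURE (ρ-R2), support-grade, census 636/636:** on R2 ∩ jump-one, `ρ(lm) = 0 ⟺ 4 ∣ g(l)` (`g(l) = #2Cl(ℚ(√−l)) = h(−4l)/2`, tree `gK`;
⟺ `8 ∣ h(−4l)` ⟺ `(2/l)₄ (l/2)₄ = +1` ⟺ `l = a² + 32b²`, Barrucand–Cohn) — a condition on `l` alone.  Same status and proof path as (ρ-R1). -/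
def RhoLawR2 : Prop :=
  ∀ (l m : ℕ) [(congruentNumberCurve (l * m)).IsElliptic], SectorR2 l m →
    (congruentNumberCurve (l * m)).analyticRank = 1 →
    Nat.card ((congruentNumberCurve (l * m)).selmerGroup 2) = 2 ^ 5 →
    Nat.card ((congruentNumberCurve (l * m)).selmerGroup 4) = 2 ^ 6 →
    ((rhoSubgroup (l * m)).index = 1 ↔ 4 ∣ gK l)

/-- **RESEARCH STATEMENT (crux-grade, BEYOND PRINT): the LOWER HALF of C⁺ on the SPECIAL stratum `ρ(n) = 0` of the odd `s ≥ 2` class.**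
Granted GZK for the rank, for every square-free odd `n ≡ 5, 7 (mod 8)` with `ord_{s=1} L(E_n, s) = 1`, `#Sel₂(E_n/ℚ) = 2^{2+s}` (`s ≥ 2`) and
`φ_n(A_n(ℚ)) + E_n[2] = E_n(ℚ)`, every integer `L` with `𝓛(n)² = L²` is even.  With `SpecialStratum.two_dvd_scriptL_odd_of_rhoIndex_ne_one_of_facts`
(this cycle) it gives the whole odd lower half (`lowerHalfOdd_of_rhoZero_of_rhoNeZero` below).  On this stratum the half `Q₁` is frozen
(`…GenusCharacterRho`): the statement is «`[Q₁] ≠ 0 ∨ depth P(n) ≥ depth Q₁ ≥ 1`» (`…LevelTwoHalves`, `…LevelTwoDepth`), a depth comparison no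
display decides.  The text is self-contained (no named fact) so that an `…OfFacts` twin is the planner's choice. -/
def LowerHalfRhoZeroOdd : Prop :=
  ∀ (n : ℕ) [(congruentNumberCurve n).IsElliptic], Squarefree n → (n % 8 = 5 ∨ n % 8 = 7) →
    (congruentNumberCurve n).analyticRank = 1 →
    ∀ s : ℕ, 2 ≤ s → Nat.card ((congruentNumberCurve n).selmerGroup 2) = 2 ^ (2 + s) →
      (rhoSubgroup n).index = 1 → ∀ L : ℤ, IsScriptL n L → (2 : ℤ) ∣ L

/-- The generator-free `ρ ≠ 0` half, as a statement (PROVED modulo `tyz_cmPointRingClassFrobeniusData ∧ thm11_parity_of_scriptL ∧ GZK` by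
`SpecialStratum.two_dvd_scriptL_odd_of_rhoIndex_ne_one_of_facts`, `Theorems/PrintCf2RamifiedOffTYZLowerHalfRhoDichotomy.lean`; restated here only
to type the composition below without importing a Theorems file into a workfile). -/
def LowerHalfRhoNeZeroOdd : Prop :=
  ∀ (n : ℕ) [(congruentNumberCurve n).IsElliptic], Squarefree n → (n % 8 = 5 ∨ n % 8 = 7) →
    (congruentNumberCurve n).analyticRank = 1 →
    ∀ s : ℕ, 2 ≤ s → Nat.card ((congruentNumberCurve n).selmerGroup 2) = 2 ^ (2 + s) →
      (rhoSubgroup n).index ≠ 1 → ∀ L : ℤ, IsScriptL n L → (2 : ℤ) ∣ L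

/-- The odd lower half of C⁺ on the whole `s ≥ 2` class (no `ρ` hypothesis). -/
def LowerHalfOdd : Prop :=
  ∀ (n : ℕ) [(congruentNumberCurve n).IsElliptic], Squarefree n → (n % 8 = 5 ∨ n % 8 = 7) →
    (congruentNumberCurve n).analyticRank = 1 →
    ∀ s : ℕ, 2 ≤ s → Nat.card ((congruentNumberCurve n).selmerGroup 2) = 2 ^ (2 + s) →
      ∀ L : ℤ, IsScriptL n L → (2 : ℤ) ∣ L

/-- **Sanity link (pure logic):** the two `ρ`-halves give the odd lower half. -/
theorem lowerHalfOdd_of_rhoZero_of_rhoNeZero (h0 : LowerHalfRhoZeroOdd) (h1 : LowerHalfRhoNeZeroOdd) : LowerHalfOdd := by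
  intro n _ hsq h57 hr s hs hsel L hL
  by_cases hρ : (rhoSubgroup n).index = 1
  · exact h0 n hsq h57 hr s hs hsel hρ L hL
  · exact h1 n hsq h57 hr s hs hsel hρ L hL

/-- **Sanity link:** C⁺'s lower half on the odd jump-one class is the case `s = 3` of `LowerHalfOdd`. -/
theorem two_dvd_of_lowerHalfOdd (h : LowerHalfOdd) (n : ℕ) [(congruentNumberCurve n).IsElliptic] (hsq : Squarefree n)
    (h57 : n % 8 = 5 ∨ n % 8 = 7) (hr : (congruentNumberCurve n).analyticRank = 1)
    (hsel : Nat.card ((congruentNumberCurve n).selmerGroup 2) = 2 ^ 5) :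
    ∀ L : ℤ, IsScriptL n L → (2 : ℤ) ∣ L :=
  h n hsq h57 hr 3 (by norm_num) (by rw [hsel])

end Summit.BirchSwinnertonDyer.PrintCf2.SpecialStratum.Laws

end
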